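import Summits.ResolutionOfSingularities.ResolutionOfSingularities.Theorems.HilbertSamuelEliminationSigmaMaxModificationsCorridor3WLadderIsoTailsFreeRationalTower
import Summits.ResolutionOfSingularities.ResolutionOfSingularities.Theorems.HilbertSamuelEliminationSigmaMaxModificationsCorridor3WLadderIsoTailsFormalFrameTower
import Summits.ResolutionOfSingularities.ResolutionOfSingularities.Theorems.HilbertSamuelEliminationSigmaMaxModificationsCorridor3WLadderIsoTailsFormalFrameBase
import Summits.ResolutionOfSingularities.ResolutionOfSingularities.Theorems.HilbertSamuelEliminationSigmaMaxModificationsCorridor3WLadderIsoTailsHSTower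
import Summits.ResolutionOfSingularities.ResolutionOfSingularities.Theorems.HilbertSamuelEliminationSigmaMaxModificationsCorridor3WLadderIsoTailsHSArcCompletion
import Literature.AlgebraicGeometry.Resolution.BlowupAlgebraPresentation
import Literature.AlgebraicGeometry.Resolution.RegularLocalRingsNormal
import HarnessLib

/-!
# [OURS · L1 W4.2 · D14 ROUTE H/G «K1 FREE-RATIONAL TAILS»] G1a-2, part 1/2: ONE STEP of the tower of formal frames
# (crux `SigmaMaxModifications` stmt-ResolutionOfSingularities-18506 / conjunct stmt-…-19249; kernel `IsoQuadraticTowerTerminates p 3`,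
# card C5 K1; `--supports stmt-ResolutionOfSingularities-19249`, helper)

Prover res-D-pv-010 (HIRONAKA-L D lane, gen 10) on res-L1-w42-plan-1's RULING v3.14-15 (DT) «G1a-2 TOWER ASSEMBLY := res-D-pv-010»,
cut of record res-L1-w42-lead-1 2026-08-27T10:43:09Z (G1a-2). HELPER file (`--supports stmt-…-19249`): closes no item, introduces no
definition, asserts nothing of [Hironaka2017] nor of [CossartJannsenSaito2020] / [CossartPiltant2008, 2009]; imports no `Theses` file.
AI-written; AI review is weaker than expert review.

## The object

The K1 arc argument runs a TOWER OF FORMAL FRAMES along a free-rational tail of an isolated point tower: local homomorphisms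
`ψ_n : R_n → κ⟦X₀, …, X₃⟧` on the regular presentation rings `R_n` of the stages (`𝒪_{X_n,x_n} ≅ R_n/(h_n)`), compatible with the
chart transitions up to the translated chart substitutions `X_i ↦ X₀ X_i + c_{n,i} X₀` (res-L1-w42-lead-1's `FormalFrame.stepFrame`,
`…IsoTailsFormalFrameStep`), whose glue `FormalFrame.mem_pow_of_frameTower` (`…IsoTailsFormalFrameTower`) puts `ψ₀(h₀)` in the `m`-th
power of the arc ideal `(X_i − Σ_k c_{k,i} X₀^k)_{i=1,2,3}`. This file proves the INDUCTION STEP of that tower in one theorem,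
`exists_frameStep`, whose output has the shape of its input (part 2/2, `…IsoTailsFormalFrameAssembly`, iterates it and plugs the
result into `mem_pow_of_frameTower`). The sockets consumed BY NAME: res-type-071's frame socket along a tower
`EmbeddedStep.exists_maximalIdeal_presentation_tower` (H5, p526483) and satellite dictionary
`EmbeddedStep.not_isSatelliteStep_iff_forall_dvd_of_eq`, res-type-001's H3 `IsoTailsHS.hilbertSamuelFun_zero_quotient_span_singleton`,
and lead-1's frame calculus (`stepFrame_algebraMap`, `stepLift_algebraMap`, `stepLift_t`, `isLocalHom_stepFrame`,
`stepLift_newCoord_sub_mem_span`, `exists_sub_C_mul_X_zero_mem_sq`, `newCoord_mem_stepPrime`, `eq_stepPrime_of_isMaximal_of_le`).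

## What is proved

* §1 POINT MATCHING (the inclusion lead-1's `eq_stepPrime_of_isMaximal_of_le` asks for): `exists_sub_algebraMap_mem` — modulo any
  ideal `J ∋ x_k/xᵢ − a_k` (all `k`) every element of `R[I/xᵢ]` is a constant (`blowupAlgebra.eval_surjective`); `le_of_forall_gen_sub_mem`
  — two such ideals with `J ∩ R ⊆ J′ ∩ R` satisfy `J ⊆ J′`. Hence the tower's point `𝔑` of res-type-071's socket EQUALS the point
  `stepPrime c₁` seen by the frame, for the matching constants `c₁,k = res(ψ ã_k) − λ_k`.
* §2 MULTIPLICITY (H1 + H3): `hilbertSamuelFun_zero_eq_hypersurfaceHFe_of_surjective` (`H^{(0)}(A) = hypersurfaceHFe e m` for a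
  presentation `σ : R ↠ A`, `ker σ = (h)`, `h ∈ 𝔪^m ∖ 𝔪^{m+1}`), `mem_pow_and_not_mem_pow_succ_of_hilbertSamuelFun_eq` — if
  `H^{(0)}(A′) = H^{(0)}(A)` for two such presentations over regular local rings of the same dimension `e ≥ 1`, the second equation has
  the same multiplicity `m` (`hypersurfaceHFe_injective`).
* §3 **`exists_frameStep` — ONE STEP.** Input at stage `n` (`T.C n = {x_n}` closed, `π_n(x_{n+1}) = x_n`): `R` regular local with
  `emb.dim R = 4` and a regular system `x` (`t = x 0`), `σ : R ↠ 𝒪_{X_n,x_n}` with `ker σ = (h)`, `h ∈ 𝔪^m ∖ 𝔪^{m+1}`, (FREE)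
  «`x_{n+1}` lies in the `t`-chart» in res-type-071's `stalkCongr` form, `IsRationalStep T pt n`, `¬ IsSatelliteStep T pt n`,
  `H^{(0)}(𝒪_{x_{n+1}}) = H^{(0)}(𝒪_{x_n})`, and a frame `ψ` (local, `ψ t = X 0`, slopes `λ`, surjective residue map). Output: the SAME
  eleven clauses at stage `n+1` for `R′ = R[𝔪/t]_𝔑`, `x′ = (t, x_k/t − ã_k)`, `σ′`, `h′`, `ψ′ = stepFrame c₁`, `λ′`, together with the
  links `ψ′ (ι r) = subst (transChartSubst c₁) (ψ r)` and `ι h = (x′ 0)^m · h′` (`ι : R → R′`) that `mem_pow_of_frameTower` consumes.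

Elaboration note: generic lemmas are applied to `Localization.AtPrime 𝔑` and to stalks with EXPLICIT type arguments (letting the
unifier solve the ring from a hypothesis is prohibitively slow on these instance towers, cf. res-type-071's heartbeat notes).

## References

* V. Cossart, O. Piltant, J. Algebra 320 (2008), proof of Lemma 4.3 (3) [CossartPiltant2008]; J. Algebra 321 (2009) ch. 3 I.9 (the
  formal arc) [CossartPiltant2009].
* U. Görtz, T. Wedhorn, *Algebraic Geometry I* (2nd ed. 2020), (13.19) p. 415. [GortzWedhorn2020]
* V. Cossart, U. Jannsen, S. Saito, LNM 2270 (2020), Thm. 2.3 (hypersurface Hilbert functions), Def. 6.34. [CossartJannsenSaito2020]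
-/

noncomputable section

set_option linter.dupNamespace false -- mandated namespace of this single-conjunct summit

open MvPowerSeries IsLocalRing AlgebraicGeometry CategoryTheory
open Literature.AlgebraicGeometry.Resolution Literature.RingTheory.HilbertSamuel
open Literature.AlgebraicGeometry.CossartJannsenSaito2020

namespace Summit.ResolutionOfSingularities.ResolutionOfSingularities.Cruxes.SigmaMaxModifications.IdeasL1C5

universe u

namespace FormalFrame

/-! ### §1. Point matching: a maximal ideal of `R[𝔪/t]` through the translated coordinates is determined by its trace on `R` -/

section PointMatching

variable {R : Type u} [CommRing R]

/-- **`R → R[I/xᵢ]/J` is onto** as soon as `J` contains `x_k/xᵢ − a_k` for constants `a_k ∈ R` (all `k`): every element of the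
chart algebra is congruent to a constant modulo `J` (`R[I/xᵢ]` is generated by the `x_k/xᵢ`, `blowupAlgebra.eval_surjective`).
[OURS · L1 W4.2] [cite: GortzWedhorn2020, (13.19) p. 415] -/
theorem exists_sub_algebraMap_mem {d : ℕ} (x : Fin d → R) (i : Fin d) {I : Ideal R}
    (hI : Ideal.span (Set.range x) = I) (hxI : ∀ k, x k ∈ I) (J : Ideal (blowupAlgebra I (x i))) (a : Fin d → R)
    (hJ : ∀ k, blowupAlgebra.gen I (x i) (x k) (hxI k) - algebraMap R _ (a k) ∈ J) (b : blowupAlgebra I (x i)) :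
    ∃ r : R, b - algebraMap R _ r ∈ J := by
  subst hI
  obtain ⟨p, rfl⟩ := blowupAlgebra.eval_surjective x i b
  induction p using MvPolynomial.induction_on with
  | C r =>
    exact ⟨r, by rw [blowupAlgebra.eval_C, sub_self]; exact J.zero_mem⟩
  | add p q hp hq =>
    obtain ⟨r, hr⟩ := hp
    obtain ⟨s, hs⟩ := hq
    refine ⟨r + s, ?_⟩
    have : blowupAlgebra.eval x i (p + q) - algebraMap R _ (r + s) =
        (blowupAlgebra.eval x i p - algebraMap R _ r) + (blowupAlgebra.eval x i q - algebraMap R _ s) := by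
      rw [map_add, map_add]; ring
    rw [this]
    exact J.add_mem hr hs
  | mul_X p j hp =>
    obtain ⟨r, hr⟩ := hp
    refine ⟨r * a j.1, ?_⟩
    have : blowupAlgebra.eval x i (p * MvPolynomial.X j) - algebraMap R _ (r * a j.1) =
        (blowupAlgebra.eval x i p - algebraMap R _ r) * blowupAlgebra.frac x i j.1 +
          algebraMap R _ r * (blowupAlgebra.frac x i j.1 - algebraMap R _ (a j.1)) := by
      rw [map_mul, blowupAlgebra.eval_X, map_mul]; ring
    rw [this]
    exact J.add_mem (J.mul_mem_right _ hr) (J.mul_mem_left _ (hJ j.1))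

/-- **POINT MATCHING, the inclusion.** Two ideals `J, J′` of `R[I/xᵢ]` both containing the translated coordinates
`x_k/xᵢ − a_k`, with `J ∩ R ⊆ J′ ∩ R`, satisfy `J ⊆ J′`. (Used with `J = 𝔑` the tower's point, res-type-071's
`exists_maximalIdeal_presentation`, and `J′ = stepPrime` the point seen by the frame, res-L1-w42-lead-1's `span_le_stepPrime`; then
`eq_stepPrime_of_isMaximal_of_le`.) [OURS · L1 W4.2] [folklore] -/
theorem le_of_forall_gen_sub_mem {d : ℕ} (x : Fin d → R) (i : Fin d) {I : Ideal R}
    (hI : Ideal.span (Set.range x) = I) (hxI : ∀ k, x k ∈ I) {J J' : Ideal (blowupAlgebra I (x i))} (a : Fin d → R)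
    (hJ : ∀ k, blowupAlgebra.gen I (x i) (x k) (hxI k) - algebraMap R _ (a k) ∈ J)
    (hJ' : ∀ k, blowupAlgebra.gen I (x i) (x k) (hxI k) - algebraMap R _ (a k) ∈ J')
    (hRR : J.comap (algebraMap R _) ≤ J'.comap (algebraMap R _)) : J ≤ J' := by
  intro b hb
  obtain ⟨r, hr⟩ := exists_sub_algebraMap_mem x i hI hxI (J ⊓ J') a (fun k => ⟨hJ k, hJ' k⟩) b
  have hrJ : algebraMap R _ r ∈ J := by
    have := J.sub_mem hb hr.1
    rwa [sub_sub_cancel] at this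
  have hrJ' : algebraMap R _ r ∈ J' := hRR (Ideal.mem_comap.mpr hrJ)
  have := J'.add_mem hr.2 hrJ'
  rwa [sub_add_cancel] at this

end PointMatching

/-! ### §2. The multiplicity of the strict transform from the Hilbert–Samuel function (H1 + H3) -/

section Multiplicity

open Summit.ResolutionOfSingularities.ResolutionOfSingularities.Theorems.SigmaMaxModificationsCorridor3.Helpers
  (hypersurfaceHFe hypersurfaceHFe_injective)
open Summit.ResolutionOfSingularities.ResolutionOfSingularities.Theorems.SigmaMaxModificationsCorridor3.IsoTailsHS
  (hilbertSamuelFun_zero_quotient_span_singleton nonempty_ringEquiv_quotient_span_of_surjective)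

/-- The Hilbert–Samuel function `H^{(0)}` of a hypersurface local ring `A ≅ R/(h)`, `R` regular local of dimension `e`,
`h ∈ 𝔪^m ∖ 𝔪^{m+1}`, is `hypersurfaceHFe e m` (H3, `hilbertSamuelFun_zero_quotient_span_singleton`, read through a
presentation `σ : R ↠ A`, `ker σ = (h)`). [OURS · L1 W4.2] [cite: CossartJannsenSaito2020, Thm. 2.3] -/
theorem hilbertSamuelFun_zero_eq_hypersurfaceHFe_of_surjective {R A : Type u} [CommRing R] [IsRegularLocalRing R]
    [CommRing A] [IsLocalRing A] [IsNoetherianRing A] {e : ℕ} (he : ringKrullDim R = e)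
    (σ : R →+* A) (hσ : Function.Surjective σ) {h : R} (hker : RingHom.ker σ = Ideal.span {h}) {m : ℕ}
    (hm : h ∈ maximalIdeal R ^ m) (hm' : h ∉ maximalIdeal R ^ (m + 1)) :
    hilbertSamuelFun A 0 = hypersurfaceHFe e m := by
  obtain ⟨eA⟩ := nonempty_ringEquiv_quotient_span_of_surjective σ hσ hker
  haveI : Nontrivial (R ⧸ Ideal.span {h}) := eA.symm.toEquiv.nontrivial
  haveI : IsLocalRing (R ⧸ Ideal.span {h}) := IsLocalRing.of_surjective' (Ideal.Quotient.mk _) Ideal.Quotient.mk_surjective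
  rw [hilbertSamuelFun_eq_of_ringEquiv eA 0]
  exact hilbertSamuelFun_zero_quotient_span_singleton he hm hm'

/-- **THE STRICT TRANSFORM KEEPS THE MULTIPLICITY** when the Hilbert–Samuel function does not move (D14 ROUTE H, H1 + H3):
for hypersurface presentations `σ : R ↠ A`, `ker σ = (h)`, `h ∈ 𝔪^m ∖ 𝔪^{m+1}` and `σ′ : R′ ↠ A′`, `ker σ′ = (h′)`, `h′ ≠ 0`,
with `R, R′` regular local of the same dimension `e ≥ 1` and `H^{(0)}(A′) = H^{(0)}(A)`: `h′ ∈ 𝔪′^m ∖ 𝔪′^{m+1}`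
(`hypersurfaceHFe e ·` is injective). [OURS · L1 W4.2] [cite: CossartJannsenSaito2020, Thm. 2.3] -/
theorem mem_pow_and_not_mem_pow_succ_of_hilbertSamuelFun_eq {R R' A A' : Type u} [CommRing R] [IsRegularLocalRing R]
    [CommRing R'] [IsRegularLocalRing R'] [CommRing A] [IsLocalRing A] [IsNoetherianRing A] [CommRing A']
    [IsLocalRing A'] [IsNoetherianRing A'] {e : ℕ} (he : 1 ≤ e) (hR : ringKrullDim R = e) (hR' : ringKrullDim R' = e)
    (σ : R →+* A) (hσ : Function.Surjective σ) {h : R} (hker : RingHom.ker σ = Ideal.span {h}) {m : ℕ}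
    (hm : h ∈ maximalIdeal R ^ m) (hm' : h ∉ maximalIdeal R ^ (m + 1))
    (σ' : R' →+* A') (hσ' : Function.Surjective σ') {h' : R'} (hker' : RingHom.ker σ' = Ideal.span {h'})
    (hh' : h' ≠ 0) (hHS : hilbertSamuelFun A' 0 = hilbertSamuelFun A 0) :
    h' ∈ maximalIdeal R' ^ m ∧ h' ∉ maximalIdeal R' ^ (m + 1) := by
  obtain ⟨m', hm'1, hm'2⟩ := exists_mem_pow_and_not_mem_pow_succ hh'
  have h1 := hilbertSamuelFun_zero_eq_hypersurfaceHFe_of_surjective hR σ hσ hker hm hm'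
  have h2 := hilbertSamuelFun_zero_eq_hypersurfaceHFe_of_surjective hR' σ' hσ' hker' hm'1 hm'2
  rw [hHS, h1] at h2
  obtain rfl : m = m' := hypersurfaceHFe_injective he h2
  exact ⟨hm'1, hm'2⟩

end Multiplicity

/-! ### §3. ONE STEP of the tower of frames along a free-rational step of the point tower -/

section Step

variable {κ : Type u} [Field κ]

/-- `(t) ⊆ 𝔪` in `κ⟦t, y⟧`. [folklore] -/
theorem span_X_zero_le_maximalIdeal :
    Ideal.span {(X 0 : MvPowerSeries (Fin 4) κ)} ≤ maximalIdeal (MvPowerSeries (Fin 4) κ) := by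
  rw [Ideal.span_le, Set.singleton_subset_iff]
  exact (mem_maximalIdeal_iff _).mpr (constantCoeff_X _)

set_option maxHeartbeats 1600000 in
-- long existential packaging over the affine blowup algebra of a stalk (as in res-type-071's socket files)
/-- **G1a-2, ONE STEP OF THE TOWER OF FORMAL FRAMES.** Stage `n` of a point tower (`T.C n = {x_n}` closed,
`π_n(x_{n+1}) = x_n`) carries: a hypersurface presentation `σ : R ↠ 𝒪_{X_n,x_n}`, `R` regular local of embedding dimension `4`
with regular system of parameters `x = (t, y₁, y₂, y₃)` (`t = x 0`), `ker σ = (h)`, `h ∈ 𝔪^m ∖ 𝔪^{m+1}`; the hypothesis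
(FREE) «`x_{n+1}` lies in the `t`-chart» (`π♯σ(t) ∣ π♯σ(x_k)`); and a FORMAL FRAME `ψ : R → κ⟦X₀,…,X₃⟧` — a local homomorphism
with `ψ t = X 0`, `ψ (x i) ≡ X i + λ_i X 0 (mod 𝔪²)` and surjective residue map. If the step is RATIONAL and NOT a SATELLITE step
and the Hilbert–Samuel function does not move (`H^{(0)}(𝒪_{x_{n+1}}) = H^{(0)}(𝒪_{x_n})`, H1), then stage `n+1` carries THE SAME
DATA: `R′ = R[𝔪/t]_𝔑` (res-type-071's `exists_maximalIdeal_presentation_tower`; here `𝔑 = stepPrime c₁` is PROVED, §1), the new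
regular system `(t, x_k/t − ã_k)`, `σ′ : R′ ↠ 𝒪_{X_{n+1},x_{n+1}}` with `ker σ′ = (h′)`, `h′ ∈ 𝔪′^m ∖ 𝔪′^{m+1}` (§2), (FREE) at
stage `n+1` (`not_isSatelliteStep_iff_forall_dvd_of_eq`), and the propagated frame `ψ′ = stepFrame c₁` (res-L1-w42-lead-1's
`…IsoTailsFormalFrameStep`) with its slopes and residue surjectivity — TOGETHER WITH the two links consumed by
`FormalFrame.mem_pow_of_frameTower`: `ψ′ ∘ ι = (y ↦ t y + c₁ t) ∘ ψ` and `ι h = t^m · h′`. [OURS · L1 W4.2]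
[cite: CossartPiltant2008, proof of Lemma 4.3 (3)] [cite: CossartPiltant2009, ch. 3 I.9] -/
theorem exists_frameStep (T : BlowupTower.{u}) (pt : ∀ n, T.X n) (n : ℕ)
    (hC : T.C n = {pt n}) (hcl : IsClosed ({pt n} : Set (T.X n))) (hpt : (T.π n) (pt (n + 1)) = pt n)
    (hpt' : (T.π (n + 1)) (pt (n + 2)) = pt (n + 1))
    (hrat : IsRationalStep T pt n) (hnsat : ¬ IsSatelliteStep T pt n)
    (hHS : hilbertSamuelFun ((T.X (n + 1)).presheaf.stalk (pt (n + 1))) 0 =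
      hilbertSamuelFun ((T.X n).presheaf.stalk (pt n)) 0)
    {R : Type u} [CommRing R] [IsRegularLocalRing R] (hd : (maximalIdeal R).spanFinrank = 4)
    (x : Fin 4 → R) (hx : Ideal.span (Set.range x) = maximalIdeal R)
    (σ : R →+* (T.X n).presheaf.stalk (pt n)) (hσ : Function.Surjective σ) {h : R}
    (hker : RingHom.ker σ = Ideal.span {h}) {m : ℕ} (hm : h ∈ maximalIdeal R ^ m)
    (hm' : h ∉ maximalIdeal R ^ (m + 1))
    (hfree : ∀ k, ((T.π n).stalkMap (pt (n + 1))).hom (((T.X n).presheaf.stalkCongr (.of_eq hpt)).inv (σ (x 0))) ∣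
      ((T.π n).stalkMap (pt (n + 1))).hom (((T.X n).presheaf.stalkCongr (.of_eq hpt)).inv (σ (x k))))
    (ψ : R →+* MvPowerSeries (Fin 4) κ) [IsLocalHom ψ] (hψt : ψ (x 0) = X 0) (lam : Fin 4 → κ)
    (hlam : ∀ i, i ≠ 0 → ψ (x i) - X i - C (lam i) * X 0 ∈ maximalIdeal (MvPowerSeries (Fin 4) κ) ^ 2)
    (hres : ∀ a : κ, ∃ r : R, ψ r - C a ∈ maximalIdeal (MvPowerSeries (Fin 4) κ)) :
    ∃ (R' : Type u) (_ : CommRing R') (_ : IsRegularLocalRing R') (x' : Fin 4 → R')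
      (σ' : R' →+* (T.X (n + 1)).presheaf.stalk (pt (n + 1))) (h' : R') (ψ' : R' →+* MvPowerSeries (Fin 4) κ)
      (lam' : Fin 4 → κ) (ι : R →+* R') (c₁ : Fin 4 → κ),
      (maximalIdeal R').spanFinrank = 4 ∧ Ideal.span (Set.range x') = maximalIdeal R' ∧
      Function.Surjective σ' ∧ RingHom.ker σ' = Ideal.span {h'} ∧
      h' ∈ maximalIdeal R' ^ m ∧ h' ∉ maximalIdeal R' ^ (m + 1) ∧
      (∀ k, ((T.π (n + 1)).stalkMap (pt (n + 2))).hom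
          (((T.X (n + 1)).presheaf.stalkCongr (.of_eq hpt')).inv (σ' (x' 0))) ∣
        ((T.π (n + 1)).stalkMap (pt (n + 2))).hom
          (((T.X (n + 1)).presheaf.stalkCongr (.of_eq hpt')).inv (σ' (x' k)))) ∧
      IsLocalHom ψ' ∧ ψ' (x' 0) = X 0 ∧
      (∀ i, i ≠ 0 → ψ' (x' i) - X i - C (lam' i) * X 0 ∈ maximalIdeal (MvPowerSeries (Fin 4) κ) ^ 2) ∧
      (∀ a : κ, ∃ r : R', ψ' r - C a ∈ maximalIdeal (MvPowerSeries (Fin 4) κ)) ∧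
      (∀ r, ψ' (ι r) = subst (Series.transChartSubst c₁) (ψ r)) ∧
      ι h = x' 0 ^ m * h' := by
  classical
  obtain ⟨a, 𝔑, h𝔑max, h', σ', h1, h2, h3, h4, h5, h6, h7, h8, h9, h10, h11, h12, h13, h14, h15, h16⟩ :=
    EmbeddedStep.exists_maximalIdeal_presentation_tower x 0 T pt n hC hcl hpt hd hx σ hσ hker hm hm' hfree hrat
  have hxm : ∀ k, x k ∈ maximalIdeal R := fun k => hx.le (Ideal.subset_span ⟨k, rfl⟩)
  -- the lifts `ã` (with `ã_0 := 1`, as `t/t = 1`) and the matching constants `c₁` (kept opaque: only their equations are used)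
  obtain ⟨A, hA0, hA⟩ : ∃ A : Fin 4 → R, A 0 = 1 ∧ ∀ k (hk : k ≠ 0), A k = a ⟨k, hk⟩ :=
    ⟨fun k => if hk : k = 0 then 1 else a ⟨k, hk⟩, dif_pos rfl, fun k hk => dif_neg hk⟩
  obtain ⟨c₁, hc₁⟩ : ∃ c₁ : Fin 4 → κ, ∀ k, c₁ k + lam k = constantCoeff (ψ (A k)) :=
    ⟨fun k => constantCoeff (ψ (A k)) - lam k, fun k => sub_add_cancel _ _⟩
  -- §1: the tower's point `𝔑` IS the point `stepPrime c₁` seen by the frame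
  have hgen𝔑 : ∀ k, blowupAlgebra.gen (maximalIdeal R) (x 0) (x k) (hxm k) - algebraMap R _ (A k) ∈ 𝔑 := by
    intro k
    by_cases hk : k = 0
    · subst hk
      rw [hA0, map_one, blowupAlgebra.gen_self, sub_self]
      exact 𝔑.zero_mem
    · rw [hA k hk]; exact h7 k hk
  have hgenS : ∀ k, blowupAlgebra.gen (maximalIdeal R) (x 0) (x k) (hxm k) - algebraMap R _ (A k) ∈
      stepPrime c₁ hψt := by
    intro k
    by_cases hk : k = 0
    · subst hk
      rw [hA0, map_one, blowupAlgebra.gen_self, sub_self]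
      exact Ideal.zero_mem _
    · have hct : ψ (A k) - C (c₁ k + lam k) ∈ maximalIdeal (MvPowerSeries (Fin 4) κ) := by
        rw [hc₁ k]; exact sub_C_constantCoeff_mem _
      exact newCoord_mem_stepPrime c₁ hψt (hxm k) hk (hlam k hk) hct
  have hRR : 𝔑.comap (algebraMap R _) ≤ (stepPrime c₁ hψt).comap (algebraMap R _) := by
    rw [h4]
    intro r hr
    rw [Ideal.mem_comap, Ideal.mem_comap, stepLift_algebraMap]
    exact span_X_zero_le_maximalIdeal (substHom_mem_span_X_zero c₁ (map_nonunit ψ r hr))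
  have h𝔑eq : 𝔑 = stepPrime c₁ hψt :=
    eq_stepPrime_of_isMaximal_of_le c₁ hψt h𝔑max (le_of_forall_gen_sub_mem x 0 hx hxm A hgen𝔑 hgenS hRR)
  -- so `R′ := R[𝔪/t]_𝔑` is a localisation at `stepPrime c₁` and carries the frame `stepFrame c₁`
  have hM : (stepPrime c₁ hψt).primeCompl = 𝔑.primeCompl :=
    Submonoid.ext fun y => by
      show y ∉ stepPrime c₁ hψt ↔ y ∉ 𝔑
      rw [h𝔑eq]
  haveI : IsLocalization.AtPrime (Localization.AtPrime 𝔑) (stepPrime c₁ hψt) := by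
    show IsLocalization (stepPrime c₁ hψt).primeCompl (Localization.AtPrime 𝔑)
    rw [hM]
    exact Localization.isLocalization
  haveI : IsRegularLocalRing (Localization.AtPrime 𝔑) := h8
  -- the new frame, transition, coordinates, equation
  set ψ' : Localization.AtPrime 𝔑 →+* MvPowerSeries (Fin 4) κ := stepFrame c₁ hψt (Localization.AtPrime 𝔑)
    with hψ'def
  set ι : R →+* Localization.AtPrime 𝔑 :=
    (algebraMap (blowupAlgebra (maximalIdeal R) (x 0)) (Localization.AtPrime 𝔑)).comp
      (algebraMap R (blowupAlgebra (maximalIdeal R) (x 0))) with hιdef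
  obtain ⟨x', hx'def⟩ : ∃ x' : Fin 4 → Localization.AtPrime 𝔑, x' = fun k =>
      if hk : k = 0 then algebraMap _ (Localization.AtPrime 𝔑)
        (algebraMap R (blowupAlgebra (maximalIdeal R) (x 0)) (x 0))
      else algebraMap _ (Localization.AtPrime 𝔑)
        (blowupAlgebra.gen (maximalIdeal R) (x 0) (x k) (hx.le (Ideal.subset_span ⟨k, rfl⟩)) -
          algebraMap R _ (a ⟨k, hk⟩)) := ⟨_, rfl⟩
  have hx'0 : x' 0 = algebraMap _ (Localization.AtPrime 𝔑) (algebraMap R (blowupAlgebra (maximalIdeal R) (x 0)) (x 0)) := by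
    rw [hx'def]; exact dif_pos rfl
  have hx'k : ∀ k (hk : k ≠ 0), x' k = algebraMap _ (Localization.AtPrime 𝔑)
      (blowupAlgebra.gen (maximalIdeal R) (x 0) (x k) (hxm k) - algebraMap R _ (a ⟨k, hk⟩)) := fun k hk => by
    rw [hx'def]; exact dif_neg hk
  set h'₁ : Localization.AtPrime 𝔑 := algebraMap (blowupAlgebra (maximalIdeal R) (x 0)) _ h' with hh'₁def
  -- `ψ′` on `R`: the commutation with the translated chart substitution
  have hψ'ι : ∀ r, ψ' (ι r) = substHom c₁ (ψ r) := fun r => by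
    rw [hψ'def, hιdef, RingHom.comp_apply, stepFrame_algebraMap, stepLift_algebraMap]
  -- `h′ ≠ 0` in `R′`: `t/1` is prime, does not divide `h′`, and lies in `𝔑`
  have hh'ne : h'₁ ≠ 0 := by
    intro h0
    obtain ⟨s, hs⟩ := (IsLocalization.map_eq_zero_iff 𝔑.primeCompl (Localization.AtPrime 𝔑) h').mp h0
    rcases h2.dvd_or_dvd (show algebraMap R _ (x 0) ∣ (s : blowupAlgebra (maximalIdeal R) (x 0)) * h' by
      rw [hs]; exact dvd_zero _) with hd' | hd'
    · obtain ⟨u, hu⟩ := hd'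
      exact s.2 (by rw [hu]; exact Ideal.mul_mem_right _ _ h6)
    · exact h3 hd'
  -- §2: the multiplicity of `h′`
  haveI : IsLocallyNoetherian (T.X n) := T.ln n
  haveI : IsLocallyNoetherian (T.X (n + 1)) := T.ln (n + 1)
  have hR4 : ringKrullDim R = ((4 : ℕ) : WithBot ℕ∞) := ringKrullDim_eq_of_spanFinrank_eq hd
  have hR'4 := @ringKrullDim_eq_of_spanFinrank_eq (Localization.AtPrime 𝔑) _ h8 4 h9
  have hmult := @mem_pow_and_not_mem_pow_succ_of_hilbertSamuelFun_eq R (Localization.AtPrime 𝔑)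
    ((T.X n).presheaf.stalk (pt n)) ((T.X (n + 1)).presheaf.stalk (pt (n + 1))) _ _ _ h8 _ _ _ _ _ _ 4 (by norm_num)
    hR4 hR'4 σ hσ h hker m hm hm' σ' h11 h'₁ h12 hh'ne hHS
  -- (FREE) at stage `n + 1` from `¬ IsSatelliteStep T pt n`
  have hD' : stalkIdeal (T.centreIdeal n) ((T.π n) (pt (n + 1))) =
      maximalIdeal ((T.X n).presheaf.stalk ((T.π n) (pt (n + 1)))) := by
    rw [hpt]; exact EmbeddedStep.stalkIdeal_centreIdeal_eq_maximalIdeal T pt n hC hcl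
  have hE := EmbeddedStep.map_maximalIdeal_stalkMap_eq_of_stalkIdeal (T.π n) (T.centreIdeal n) (pt (n + 1)) hD' h15
  have hc' : Ideal.span (Set.range fun k => σ' (x' k)) = maximalIdeal ((T.X (n + 1)).presheaf.stalk (pt (n + 1))) := by
    have hr : (Set.range fun k => σ' (x' k)) = σ' '' Set.range x' := by
      rw [← Set.range_comp]; rfl
    rw [hr, ← Ideal.map_span, hx'def, h10]
    exact IsLocalRing.map_maximalIdeal_of_surjective (R := Localization.AtPrime 𝔑)
      (S := (T.X (n + 1)).presheaf.stalk (pt (n + 1))) σ' h11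
  have hg : σ' (x' 0) =
      ((T.π n).stalkMap (pt (n + 1))).hom (((T.X n).presheaf.stalkCongr (.of_eq hpt)).inv (σ (x 0))) := by
    rw [hx'0]; exact h13 (x 0)
  have hfree' := (EmbeddedStep.not_isSatelliteStep_iff_forall_dvd_of_eq T pt n hpt' hE hc').mp hnsat
  -- the new slopes
  have hz : ∀ i (hi : i ≠ 0), ψ' (x' i) - X i ∈ Ideal.span {(X 0 : MvPowerSeries (Fin 4) κ)} := by
    intro i hi
    have hct : ψ (a ⟨i, hi⟩) - C (c₁ i + lam i) ∈ maximalIdeal (MvPowerSeries (Fin 4) κ) := by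
      rw [hc₁ i, hA i hi]; exact sub_C_constantCoeff_mem _
    have := stepLift_newCoord_sub_mem_span c₁ hψt (hxm i) hi (hlam i hi) hct
    rw [hx'k i hi, hψ'def, stepFrame_algebraMap]
    exact this
  have hl : ∀ i (hi : i ≠ 0), ∃ lam' : κ,
      ψ' (x' i) - X i - C lam' * X 0 ∈ maximalIdeal (MvPowerSeries (Fin 4) κ) ^ 2 :=
    fun i hi => exists_sub_C_mul_X_zero_mem_sq (hz i hi)
  choose lamf hlamf using hl
  obtain ⟨lam', hlam'⟩ : ∃ lam' : Fin 4 → κ, ∀ i (hi : i ≠ 0), lam' i = lamf i hi :=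
    ⟨fun i => if hi : i = 0 then 0 else lamf i hi, fun i hi => dif_neg hi⟩
  -- assemble
  refine ⟨Localization.AtPrime 𝔑, inferInstance, h8, x', σ', h'₁, ψ', lam', ι, c₁, h9, ?_, h11, h12,
    hmult.1, hmult.2, ?_, ?_, ?_, ?_, ?_, ?_, ?_⟩
  · -- the new regular system of parameters
    rw [hx'def]; exact h10
  · -- (FREE) at stage `n + 1`
    intro k
    rw [hg]
    exact hfree' k
  · -- `ψ′` is local
    rw [hψ'def]; exact isLocalHom_stepFrame c₁ hψt _
  · -- `ψ′ (t) = t`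
    rw [hx'0, hψ'def, stepFrame_algebraMap, stepLift_t]
  · -- slopes
    intro i hi
    rw [hlam' i hi]
    exact hlamf i hi
  · -- residue surjectivity
    intro a₀
    obtain ⟨r, hr⟩ := hres a₀
    refine ⟨ι r, ?_⟩
    rw [hψ'ι]
    exact span_X_zero_le_maximalIdeal (substHom_sub_C_mem_span c₁ hr)
  · -- the commutation
    intro r
    rw [hψ'ι, substHom_apply]
  · -- the strict transform
    rw [hιdef, RingHom.comp_apply, h1, map_mul, map_pow, hx'0]

end Step

end FormalFrame

end Summit.ResolutionOfSingularities.ResolutionOfSingularities.Cruxes.SigmaMaxModifications.IdeasL1C5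

end
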